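import Summits.Ventures.HodgeRepro2.T5DyadicExamples
import Summits.Ventures.HodgeRepro2.T5CoprimeCompositum

/-!
# T5DyadicPlaces — the dyadic places of the cyclic cubic field: «inert or split completely»,
and «D = ∅ or D = all»

Kernel witness (cell pub-hodge-repro2, seat p3, Tier-5 support for sub-step N2) for the two
place-counting one-liners of route/T5-N2-route-3.md §N2.8.2:

* (b) «… so 2 is inert (g₂ = 1, F⁺_w ≅ the unramified cubic extension of ℚ₂) or splits
  completely (g₂ = 3, F⁺_w = ℚ₂)»;
* (c) «… «w non-split in E» is constant on the Gal(F⁺/ℚ)-orbit of dyadic places … — so D = ∅ or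
  D = all».

What is kernel-checked here (Mathlib's Hilbert ramification theory in Galois extensions of
Dedekind domains, plus the cell's own T5DyadicExamples / T5CoprimeCompositum; nothing
re-declared): for a Galois extension `B / A` of domains with Galois group `G` and a prime `p` of
`A`,

* `primesOver_ncard_mul_inertiaDegIn_eq_card_of_unramified`: if `p` is unramified
  (`ramificationIdxIn p B = 1`) then `r · f = |G|` (Mathlib's fundamental identity
  `r · (e · f) = |G|`);
* `inert_or_split_of_card_three`: for `|G| = 3` and `p` unramified, either `r = 1, f = 3` (inert)
  or `r = 3, f = 1` (splits completely) — line (b) with `F⁺ / ℚ` cyclic cubic and `p = 2`;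
* `primesOver_ncard_of_card_six`: for `|G| = 6` and `p` unramified, `(r, f)` is one of
  `(1, 6), (2, 3), (3, 2), (6, 1)` — the sextic `E / ℚ` (N2.8.2(e): ℚ(ζ₉) has `r = 1`);
* `stable_subset_primesOver_eq_empty_or_univ`: a `G`-stable set of primes over `p` is empty or
  all of them (Mathlib: `G` acts transitively on `primesOver p B`) — line (c)'s «D = ∅ or D = all».

What stays prose (labels unchanged): that `2` is unramified in `F⁺` (conductor–discriminant,
N2.8.2(b)), that «non-split in `E`» is `Gal(F⁺/ℚ)`-stable (every `σ` extends to `E`,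
`T5CoprimeCompositum.exists_extension_of_normal`, and transports the splitting behaviour), and
the identification of `g₂`, `f` with Mathlib's `ncard (primesOver p B)`, `inertiaDegIn p B`.

README §8(d): this file uses an L-value-free non-vanishing device: NO.
-/

namespace Summit.Ventures.HodgeRepro2.T5DyadicPlaces

open Ideal

variable {A : Type*} [CommRing A] [IsDomain A] (p : Ideal A) [p.IsPrime]
  (B : Type*) [CommRing B] [IsDomain B] [Algebra A B] [Module.Finite A B] [Module.Flat A B]
  (G : Type*) [Group G] [Finite G] [MulSemiringAction G B] [IsGaloisGroup G A B]

/-- For an unramified prime, the fundamental identity reads `r · f = |G|`. -/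
theorem primesOver_ncard_mul_inertiaDegIn_eq_card_of_unramified
    (he : ramificationIdxIn p B = 1) :
    (primesOver p B).ncard * inertiaDegIn p B = Nat.card G := by
  have h := ncard_primesOver_mul_ramificationIdxIn_mul_inertiaDegIn p B G
  rwa [he, one_mul] at h

/-- N2.8.2(b): in a Galois extension with group of order `3` (the cyclic cubic `F⁺ / ℚ`), an
unramified prime is inert (`r = 1`, `f = 3`) or splits completely (`r = 3`, `f = 1`). -/
theorem inert_or_split_of_card_three (hG : Nat.card G = 3) (he : ramificationIdxIn p B = 1) :
    ((primesOver p B).ncard = 1 ∧ inertiaDegIn p B = 3) ∨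
      ((primesOver p B).ncard = 3 ∧ inertiaDegIn p B = 1) := by
  have h := primesOver_ncard_mul_inertiaDegIn_eq_card_of_unramified p B G he
  rw [hG] at h
  have h' : 1 * inertiaDegIn p B * (primesOver p B).ncard = 3 := by rw [one_mul, mul_comm]; exact h
  rcases T5DyadicExamples.inert_or_split_of_unramified h' rfl with ⟨hf, hr⟩ | ⟨hf, hr⟩
  · exact Or.inl ⟨hr, hf⟩
  · exact Or.inr ⟨hr, hf⟩

/-- The sextic case: in a Galois extension with group of order `6` (the Galois CM field
`E / ℚ`), an unramified prime has `(r, f) ∈ {(1, 6), (2, 3), (3, 2), (6, 1)}`. -/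
theorem primesOver_ncard_of_card_six (hG : Nat.card G = 6) (he : ramificationIdxIn p B = 1) :
    ((primesOver p B).ncard = 1 ∧ inertiaDegIn p B = 6) ∨
      ((primesOver p B).ncard = 2 ∧ inertiaDegIn p B = 3) ∨
      ((primesOver p B).ncard = 3 ∧ inertiaDegIn p B = 2) ∨
      ((primesOver p B).ncard = 6 ∧ inertiaDegIn p B = 1) := by
  have h := primesOver_ncard_mul_inertiaDegIn_eq_card_of_unramified p B G he
  rw [hG] at h
  have hr : (primesOver p B).ncard ∣ 6 := ⟨inertiaDegIn p B, h.symm⟩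
  have hr6 : (primesOver p B).ncard ∈ Nat.divisors 6 := by
    rw [Nat.mem_divisors]
    exact ⟨hr, by norm_num⟩
  have hdiv : Nat.divisors 6 = {1, 2, 3, 6} := by decide
  rw [hdiv] at hr6
  simp only [Finset.mem_insert, Finset.mem_singleton] at hr6
  rcases hr6 with h1 | h2 | h3 | h6
  · left; exact ⟨h1, by rw [h1, one_mul] at h; exact h⟩
  · right; left; exact ⟨h2, by rw [h2] at h; omega⟩
  · right; right; left; exact ⟨h3, by rw [h3] at h; omega⟩
  · right; right; right; exact ⟨h6, by rw [h6] at h; omega⟩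

omit [IsDomain A] [p.IsPrime] [IsDomain B] [Module.Finite A B] [Module.Flat A B] in
/-- N2.8.2(c), «D = ∅ or D = all»: a `G`-stable set of primes of `B` over `p` is empty or all of
them, because `G` acts transitively on `primesOver p B` (Mathlib). -/
theorem stable_subset_primesOver_eq_empty_or_univ (D : Set (primesOver p B))
    (hD : ∀ σ : G, ∀ P ∈ D, σ • P ∈ D) : D = ∅ ∨ D = Set.univ :=
  T5CoprimeCompositum.eq_empty_or_univ_of_smul_stable D hD

end Summit.Ventures.HodgeRepro2.T5DyadicPlaces
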